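import Summits.Ventures.DiscreteObjects.Hadamard.PrimeCentralizerFaithful668
import Summits.Ventures.DiscreteObjects.Hadamard.ElemAbelianSummary668C

/-!
# H(668): for EVERY prime `p ≥ 13` of the spectrum the centraliser of an element of order `p` acts faithfully on its row orbits
# (kernel; uniform, via the rank-2 exclusion)

Framing: lottery ticket; floor = certified bounds/negative ranges.

Cell pub-namedobj (venture DiscreteObjects), target (H), hadamard gen 21.  Sharpening of `PrimeCentralizerFaithful668` (engine for
`p = 37, 41`, counting only) which could not reach `p = 13, 23` because there an element of order `p` may fix `≥ p` rows.  The missing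
step is supplied by the rank-2 census (gens 16–17, `no_hadamard668_elemAbelian_rank2_ge7`: no `C_p × C_p` for `p ≥ 7`): a power `Q`
of pair order `p` of the correcting element `ρ = τσ^m` commutes with `σ` and fixes the orbit of `x₀` pointwise, so it is not a power
of `σ` — but then `⟨σ, Q⟩ ≅ C_p × C_p` (dictionary lemma `rowIndep_of_not_pow`, gen 21), excluded.  Powers of prime order `q ≠ p` are
trivial on all moved rows, i.e. fix `≥ 668 − 44 > 332` rows, excluded by the uniform census bound `card_fixed_le_332_of_prime_pair`.
* **`centralizer_rowOrbits_of_prime_ge13`**: `p` prime, `13 ≤ p`; `σ = (π, κ, d, e)` a signed automorphism of an H(668) with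
  `π^p = κ^p = 1`, `(π, κ) ≠ (1,1)`; `τ = (π', κ', d', e')` a signed automorphism with parts commuting with `π`, `κ` and mapping every
  `π`-moved row into its own orbit.  Then `(π', κ') = (π^c, κ^c)`.  (By the spectrum, `p ∈ {13, 23, 37, 41, 83, 167}`.)
* Instances **`hadamard668_order13_centralizer_rowOrbits`**, **`hadamard668_order23_centralizer_rowOrbits`**; for `37, 41, 83, 167`
  this re-derives `PrimeCentralizerFaithful668`, `Order83Centralizer668` and gen 19's `Order167Centralizer668`.
So: **for every prime `p ≥ 13` and every element `σ` of order `p` of Aut± of a hypothetical H(668), `C(σ)/⟨σ⟩` acts FAITHFULLY on the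
set of `σ`-orbits of rows** (`48`, `29` or `28`, `18`, `16`, `8`, `4` orbits respectively).  STRUCTURE of a hypothetical object;
H(668) untouched; HITS 0/4.  Ours; no `sorry`, no definitions, default heartbeats.
-/

namespace Summit.Ventures.DiscreteObjects.Hadamard

open Finset BigOperators Matrix

open Literature.Combinatorics.Designs.GoethalsSeidel (IsHadamardMatrix)

variable {ι : Type*} [Fintype ι] [DecidableEq ι]

section engine
variable {H : Matrix ι ι ℤ}

/-- **Faithful action of the centraliser on the orbits, all primes `p ≥ 13`.**  See the module docstring. -/
theorem centralizer_rowOrbits_of_prime_ge13 (hH : IsHadamardMatrix H) (hι : Fintype.card ι = 668) {p : ℕ} (hp : p.Prime)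
    (hp13 : 13 ≤ p) {π κ π' κ' : Equiv.Perm ι} {d e d' e' : ι → ℤ} (haut : IsSignedAut H π κ d e)
    (hπ : π ^ p = 1) (hκ : κ ^ p = 1) (hne : π ≠ 1 ∨ κ ≠ 1) (haut' : IsSignedAut H π' κ' d' e')
    (hcπ : Commute π' π) (hcκ : Commute κ' κ) (hpres : ∀ x, π x ≠ x → ∃ c : ℕ, π' x = (π ^ c) x) :
    ∃ c : ℕ, π' = π ^ c ∧ κ' = κ ^ c := by
  have hcard : (Fintype.card ι : ℤ) ≠ 0 := by rw [hι]; norm_num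
  have hodd : Odd p := hp.odd_of_ne_two (by omega)
  -- the fixed rows of σ: at most 44
  have hF : (univ.filter fun i => π i = i).card ≤ 44 := by
    obtain ⟨-, h⟩ := hadamard668_signedAut_fixedRows hH hι p hp hp13 π κ d e haut hπ hκ hne
    rcases h with ⟨-, h⟩ | ⟨-, h | h⟩ | ⟨-, h⟩ | ⟨-, h⟩ | ⟨-, h⟩ | ⟨-, h⟩ <;> omega
  -- π ≠ 1, so there is a moved row
  have hπ1 : π ≠ 1 := by
    intro h1
    have hall : (univ.filter fun i : ι => π i = i) = univ :=
      Finset.filter_true_of_mem (fun i _ => by rw [h1, Equiv.Perm.one_apply])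
    rw [hall, Finset.card_univ, hι] at hF
    omega
  obtain ⟨x₀, hx₀⟩ : ∃ x, π x ≠ x := by
    by_contra h
    push Not at h
    exact hπ1 (Equiv.ext h)
  have hfree : ∀ x, π x ≠ x → ∀ k, 0 < k → k < p → (π ^ k) x ≠ x :=
    fun x hx => free_of_fixed_prime_pow π hp (by rw [hπ, Equiv.Perm.one_apply]) hx
  obtain ⟨c₀, hc₀⟩ := hpres x₀ hx₀
  obtain ⟨m, q₀, hm⟩ : ∃ m q₀ : ℕ, c₀ + m = p * q₀ := ⟨p - c₀ % p, c₀ / p + 1, by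
    have h1 := Nat.div_add_mod c₀ p; have h2 := Nat.mod_lt c₀ hp.pos; rw [Nat.mul_add, mul_one]; omega⟩
  -- ρ = τ σ^m with parts ψ, χ
  have hρ := isSignedAut_mul haut' (isSignedAut_pow haut m)
  set ψ : Equiv.Perm ι := π' * π ^ m with hψdef
  set χ : Equiv.Perm ι := κ' * κ ^ m with hχdef
  have hcψ : Commute ψ π := hcπ.mul_left (Commute.pow_left (Commute.refl π) m)
  have hcχ : Commute χ κ := hcκ.mul_left (Commute.pow_left (Commute.refl κ) m)
  have hψpow : ∀ x, π x ≠ x → ∃ c : ℕ, ψ x = (π ^ c) x := by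
    intro x hx
    obtain ⟨c, hc⟩ := hpres x hx
    refine ⟨c + m, ?_⟩
    rw [hψdef, Equiv.Perm.mul_apply, comm_apply_pow_orbit hcπ hc m, ← Equiv.Perm.mul_apply, ← pow_add]
  have hψx₀ : ψ x₀ = (π ^ 0) x₀ := by
    rw [hψdef, Equiv.Perm.mul_apply, comm_apply_pow_orbit hcπ hc₀ m, ← Equiv.Perm.mul_apply, ← pow_add, hm, pow_mul,
      hπ, one_pow, pow_zero]
  have hfixorb : ∀ n k : ℕ, (ψ ^ n) ((π ^ k) x₀) = (π ^ k) x₀ := by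
    intro n k
    rw [comm_pow_apply_pow_orbit hcψ hψx₀ n k, mul_zero, pow_zero, Equiv.Perm.one_apply]
  -- the pair R = (ψ, χ) is trivial: no prime divides its order
  set R : Equiv.Perm ι × Equiv.Perm ι := (ψ, χ) with hRdef
  have hR0 : orderOf R ≠ 0 := (orderOf_pos R).ne'
  have hpowpair : ∀ k : ℕ, R ^ k = ((ψ ^ k, χ ^ k) : Equiv.Perm ι × Equiv.Perm ι) := fun k => by rw [hRdef, Prod.pow_mk]
  have hR1 : R = 1 := by
    by_contra hR1
    have hord1 : orderOf R ≠ 1 := fun h => hR1 (orderOf_eq_one_iff.mp h)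
    obtain ⟨q, hq, hqdvd⟩ := Nat.exists_prime_and_dvd hord1
    set k := orderOf R / q with hk
    have hQ : orderOf (R ^ k) = q := orderOf_pow_orderOf_div hR0 hqdvd
    rw [hpowpair k] at hQ
    obtain ⟨h1, h2, h3⟩ := pow_data_of_orderOf hQ (a := 1) Nat.one_pos hq.one_lt
    rw [pow_one, pow_one] at h3
    have hautQ := isSignedAut_pow hρ k
    by_cases hqp : q = p
    · -- Q has order p, commutes with σ, fixes the orbit of x₀: not a power of σ, so C_p × C_p — excluded
      subst hqp
      have hnot : ∀ c : ℕ, ψ ^ k = π ^ c → χ ^ k ≠ κ ^ c := by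
        intro c hc hc'
        -- π^c fixes x₀, so p ∣ c, so Q is trivial
        have hx : (π ^ c) x₀ = x₀ := by
          have h := hfixorb k 0
          rw [pow_zero, Equiv.Perm.one_apply, hc] at h
          exact h
        have hc0 : c % q = 0 := by
          by_contra hne0
          rw [← pow_mod_of_pow_eq_one π hπ c] at hx
          exact hfree x₀ hx₀ (c % q) (Nat.pos_of_ne_zero hne0) (Nat.mod_lt _ hp.pos) hx
        have hπc : π ^ c = 1 := by rw [← pow_mod_of_pow_eq_one π hπ c, hc0, pow_zero]
        have hκc : κ ^ c = 1 := by rw [← pow_mod_of_pow_eq_one κ hκ c, hc0, pow_zero]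
        rw [hπc] at hc
        rw [hκc] at hc'
        rcases h3 with h | h
        · exact h hc
        · exact h hc'
      have hind := rowIndep_of_not_pow hH hcard hp hodd haut hautQ hπ hκ hne h1 h2 (hcχ.pow_left k) hnot
      exact no_hadamard668_elemAbelian_rank2_ge7 hH hι q hp (by omega) haut hautQ hπ hκ h1 h2 (hcψ.pow_left k).symm
        (hcχ.pow_left k).symm hind
    · -- Q is trivial on every moved row: it fixes ≥ 668 − 44 > 332 rows
      have hQmoved : ∀ x, π x ≠ x → (ψ ^ k) x = x := by
        intro x hx
        obtain ⟨c, hc⟩ := hψpow x hx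
        have e1 : (ψ ^ k) x = (π ^ (k * c)) x := by
          have h := comm_pow_apply_pow_orbit hcψ hc k 0
          rw [pow_zero, Equiv.Perm.one_apply] at h
          exact h
        have e2 : (π ^ (q * (k * c))) x = x := by
          have h := comm_pow_apply_pow_orbit hcψ hc (q * k) 0
          rw [pow_zero, Equiv.Perm.one_apply, mul_comm q k, pow_mul, h1, Equiv.Perm.one_apply] at h
          rw [show q * (k * c) = k * q * c by ring]
          exact h.symm
        have hdvd : p ∣ q * (k * c) := by
          by_contra hnd
          have hmod : (q * (k * c)) % p ≠ 0 := fun h0 => hnd (Nat.dvd_of_mod_eq_zero h0)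
          rw [← pow_mod_of_pow_eq_one π hπ (q * (k * c))] at e2
          exact hfree x hx _ (Nat.pos_of_ne_zero hmod) (Nat.mod_lt _ hp.pos) e2
        have hdvd' : p ∣ k * c :=
          (Nat.Coprime.dvd_of_dvd_mul_left ((Nat.coprime_primes hp hq).mpr (Ne.symm hqp)) hdvd)
        obtain ⟨t, ht⟩ := hdvd'
        rw [e1, ht, pow_mul, hπ, one_pow, Equiv.Perm.one_apply]
      have hsub : (univ.filter fun x => π x ≠ x) ⊆ univ.filter fun x => (ψ ^ k) x = x := by
        intro x hx
        exact Finset.mem_filter.mpr ⟨Finset.mem_univ _, hQmoved x (Finset.mem_filter.mp hx).2⟩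
      have hmovedcard : 624 ≤ (univ.filter fun x => π x ≠ x).card := by
        have h := Finset.card_filter_add_card_filter_not (s := (univ : Finset ι)) (fun x => π x = x)
        rw [Finset.card_univ, hι] at h
        have : (univ.filter fun x => ¬ π x = x) = univ.filter fun x => π x ≠ x := rfl
        rw [this] at h
        omega
      have hge := Finset.card_le_card hsub
      have hle := card_fixed_le_332_of_prime_pair hH hι hautQ hq h1 h2 h3
      omega
  rw [hRdef, Prod.mk_eq_one] at hR1
  refine ⟨(p - 1) * m, ?_, ?_⟩
  · have hb : π ^ m * π ^ ((p - 1) * m) = 1 := by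
      rw [← pow_add, show m + (p - 1) * m = p * m by
        rcases Nat.exists_eq_succ_of_ne_zero hp.ne_zero with ⟨r, hr⟩; rw [hr]; simp; ring, pow_mul, hπ, one_pow]
    calc π' = π' * (π ^ m * π ^ ((p - 1) * m)) := by rw [hb, mul_one]
      _ = (π' * π ^ m) * π ^ ((p - 1) * m) := by rw [mul_assoc]
      _ = π ^ ((p - 1) * m) := by rw [← hψdef, hR1.1, one_mul]
  · have hb : κ ^ m * κ ^ ((p - 1) * m) = 1 := by
      rw [← pow_add, show m + (p - 1) * m = p * m by
        rcases Nat.exists_eq_succ_of_ne_zero hp.ne_zero with ⟨r, hr⟩; rw [hr]; simp; ring, pow_mul, hκ, one_pow]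
    calc κ' = κ' * (κ ^ m * κ ^ ((p - 1) * m)) := by rw [hb, mul_one]
      _ = (κ' * κ ^ m) * κ ^ ((p - 1) * m) := by rw [mul_assoc]
      _ = κ ^ ((p - 1) * m) := by rw [← hχdef, hR1.2, one_mul]

end engine

/-! ### instances: 13 and 23 (the two primes not reachable by counting alone) -/

section instances
variable {H : Matrix ι ι ℤ} (hH : IsHadamardMatrix H) (hι : Fintype.card ι = 668)
  {π κ π' κ' : Equiv.Perm ι} {d e d' e' : ι → ℤ} (haut : IsSignedAut H π κ d e)
  (haut' : IsSignedAut H π' κ' d' e') (hcπ : Commute π' π) (hcκ : Commute κ' κ)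
  (hpres : ∀ x, π x ≠ x → ∃ c : ℕ, π' x = (π ^ c) x)
include hH hι haut haut' hcπ hcκ hpres

/-- **Order 13: the orbit-preserving centraliser is `⟨σ⟩`** (faithful action on the `48` row orbits; `44` fixed rows). -/
theorem hadamard668_order13_centralizer_rowOrbits (hπ : π ^ 13 = 1) (hκ : κ ^ 13 = 1) (hne : π ≠ 1 ∨ κ ≠ 1) :
    ∃ c : ℕ, π' = π ^ c ∧ κ' = κ ^ c :=
  centralizer_rowOrbits_of_prime_ge13 hH hι (by norm_num) le_rfl haut hπ hκ hne haut' hcπ hcκ hpres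

/-- **Order 23: the orbit-preserving centraliser is `⟨σ⟩`** (faithful action on the `29` resp. `28` row orbits, both census
types). -/
theorem hadamard668_order23_centralizer_rowOrbits (hπ : π ^ 23 = 1) (hκ : κ ^ 23 = 1) (hne : π ≠ 1 ∨ κ ≠ 1) :
    ∃ c : ℕ, π' = π ^ c ∧ κ' = κ ^ c :=
  centralizer_rowOrbits_of_prime_ge13 hH hι (by norm_num) (by norm_num) haut hπ hκ hne haut' hcπ hcκ hpres

end instances

end Summit.Ventures.DiscreteObjects.Hadamard
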